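import Literature.MathematicalPhysics.QuantumFieldTheory.Balaban1983to89.B9LettersZQstarFieldsAtPinsL2
import Literature.MathematicalPhysics.QuantumFieldTheory.Balaban1983to89.B9LettersZQstarFieldsAtPinsR

/-!
# `Balaban1983to89.B9LettersZQstarFieldsAtPinsL2R` — [B9] Theorems 3.12–3.13 (pp. 420–426), the block-L² lines (3.46): the `Q*`- and `Q`-composite block-L²
# letter fields of the rows-20–21 pair schemas (`Letters313L2Pk ∕ L2Pc ∕ L2PZ .gQs ∕ .dGQs ∕ .ddGQs ∕ .q`, `Letters313L2MZ.dGQsd`) AT THE PINS OVER AN ARBITRARY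
# BACKGROUND CARRIER — the carrier-generic twins of dag-n06-w5's `B9LettersZQstarFieldsAtPinsL2`, for the R-generic certificate

T. Bałaban, *Propagators for lattice gauge theories in a background field*, Commun. Math. Phys. **99** (1985) 389–434 [`Balaban1985BackgroundPropagators`, "B9"];
[4] = T. Bałaban, *Propagators and renormalization transformations for lattice gauge theories. II*, Commun. Math. Phys. **96** (1984) 223–250 [`Balaban1984PropagatorsII`];
[3] = part I, Commun. Math. Phys. **95** (1984) 17–40 [`Balaban1984PropagatorsI`].

statement-level skeleton of published theorems with citation tags; proofs where landed; nothing here is a claim about the Yang–Mills mass gap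

WHY (cell `pub-ymgap`, node N06, bundle F7 rows 20–21, seat dag-n06-l g31, memo `DISPLAY-LEDGER-ROWS2021.md` §7 = P-DISP 6; dag-n06-d g20's consumer word «WORTH DOING»,
cell INBOX 2026-08-29 22:45Z).  The N06 certificate (dag-n06-d, editions ≥ 93 «UT») lives on the R-GENERIC carrier `bg9YR (M_N(ℂ)) SU(N) R₁ R₂ x` and still DISPLAYS, inside
its block-L² pair binder `hLL2 : … Letters313L2Pk … ∧ Letters313L2MZ …`, the five (3.46)-type letters of the composites `G₀Q*`, `∇_UG₀Q*`, `∇_ν∇_μG₀Q*`, `∇_{U,ν}G₀Q*` and of `Q` —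
although it DERIVES the G₀ block-L² layer `(hG0C …).2.2 : Thm33G0L2M … B12₂ δ12₀ U` (fields `l0 l1 l3 l1d`) and holds the pins `hQsco12 ∕ hQco12`.  dag-n06-w5's
`B9LettersZQstarFieldsAtPinsL2` derives each of the five fields from exactly those layer fields + the pinned block-L² letters of `Q* ∕ Q` — but at the SU(N) member carrier
`bg9Y … x`, reading the transporter contraction (and `Q*` = adjoint of `Q`) off `(bg9Y …).Reg335`.  THIS FILE re-states them for an ARBITRARY background carrier `B` with a
configuration map `cfg : B.Cfg → CfgY (M_N(ℂ)) x.toKIdx` and the ONE hypothesis the proofs use, `hUG : ∀ μ z, cfg U μ z ∈ SU(N)` (at the certificate: `mem_of_reg335R hGR x hU`):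
§0 ★ `dotProduct_QcoKH_eqB` (`Q*` is the adjoint of `Q` at SU(N)-valued configurations of any carrier — def-Y's `isTransposePair_QcoKH_QscoKH`) and ★ `blockBd_Q_pinsB_len`
(the block-L² `Q`-letter, length-ratio form, transposed from w5's carrier-generic `blockBd_QscoKH_len` by n06-l's `blockBd_of_adjoint`); §1–§4 ★★ `gQs_l2_pinsB`, `dGQs_l2_pinsB`,
`dGQsd_l2_pinsB`, `ddGQs_l2_pinsB`, ★ `q_l2_pinsB` — statements = w5's with the carrier generalised, proofs VERBATIM over the generic cores (`blockBd_QscoKH_len` +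
`B9LettersZQstarFieldsAtPinsR.hpar_of_mem`; dag-n06-l's `gQs_l2_of_l0 ∕ dGQs_l2_of_l1 ∕ ddGQs_l2_of_l3`).
HONEST SCOPE.  Kinematic∕bookkeeping compositions; the G₀ block-L² lines (`hl0 ∕ hl1 ∕ hl1d ∕ hl3`) and the row-sum letter are HYPOTHESES of each theorem; nothing of [B9]'s
Theorems 3.3 ∕ 3.12 ∕ 3.13 is asserted; COUNT-NEUTRAL; N06 NOT discharged; one finite lattice at a time; nothing continuum, nothing about the mass gap ∕ Clay.  NEW file; w5's
file untouched.
-/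

noncomputable section

namespace Literature.MathematicalPhysics.QuantumFieldTheory.Balaban1983to89.B9LettersZQstarFieldsAtPinsL2R

open scoped Matrix.Norms.L2Operator
open Node00 B6GlobalChartV1 B6KLevelCensusIndexV1
open B6Geom246MultiLevelTorus (geomT)
open B6Ineq2142KLevelV1 (β lvl)
open B7Prop2SpecialUnitary (specialUnitaryUnits specialUnitaryUnits_le_unitaryUnits)
open B9PinMembersKLevelV1 (MemberY geo9Y bg9Y)
open B9CoReadingCoordsTranspose (TrIdx trBasis)
open B9CoReadingCoords (XBK blkBK)
open B9CoReadingCoordsH (XHK blkHK)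
open B9GeoNormsKLevelV1 (geo9K geo9K_dist_nonneg)
open B9GeoLemma21KLevelV1 (geo9Y_dist_triangle geo9Y_dist_comm geo9Y_len_pos geo9K_one_le_L geo9K_len_pos geo9K_dist_comm)
open B9Thm34Ext (toB6)
open B9SectDL2Decay (BlockBd)
open B11SectG (RowSum)
open B9Thm312Whole (Ops GeoOK)
open Node00.OpsYSectDCoords (QscoKH QcoKH isTransposePair_QcoKH_QscoKH)
open B9QstarLettersAtPinsL2 (blockBd_QscoKH_len)
open B9LettersZQstarFieldsAtPinsR (hpar_of_mem)
open B9Thm313WholeQstarFromG0 (gQs_l2_of_l0 dGQs_l2_of_l1 ddGQs_l2_of_l3)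

variable {d ℓ : ℕ} {hd : 1 ≤ d + 1} {hL : Odd (ℓ + 1) ∧ 1 < ℓ + 1} {b₀ b₁ : ℝ} {Mstar : ℕ} {N : ℕ}
variable [∀ x : MemberY d ℓ hd hL b₀ b₁ Mstar, Fintype (geo9Y x).Site]

/-! ## §0 `Q*` is the adjoint of `Q`, and the block-L² `Q`-letter, over any carrier -/

omit [∀ x : MemberY d ℓ hd hL b₀ b₁ Mstar, Fintype (geo9Y x).Site] in
/-- ★ `Q*` is the adjoint of `Q` at the pins for the dot products, `u ⬝ᵥ QF = Q*u ⬝ᵥ F`, at an `SU(N)`-valued configuration of ANY carrier (def-Y's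
`isTransposePair_QcoKH_QscoKH` in `dotProduct` form; w5's `dotProduct_QcoKH_eq` with the carrier generalised). [cite: Balaban1985BackgroundPropagators, (3.13) p.393 («Q* the adjoint of Q»)] -/
theorem dotProduct_QcoKH_eqB (x : MemberY d ℓ hd hL b₀ b₁ Mstar) {B : B9.Backgrounds} {cfg : B.Cfg → CfgY (Matrix (Fin N) (Fin N) ℂ) x.toKIdx}
    {U : B.Cfg} (hUG : ∀ μ z, cfg U μ z ∈ specialUnitaryUnits (Fin N))
    (u : XHK (TrIdx N) x.toKIdx → ℝ) (F : XBK (TrIdx N) x.toKIdx → ℝ) :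
    u ⬝ᵥ QcoKH x.toKIdx (trBasis N) B cfg (parBY x.toKIdx) U F = QscoKH x.toKIdx (trBasis N) B cfg (parBY x.toKIdx) U u ⬝ᵥ F := by
  have hT := isTransposePair_QcoKH_QscoKH x.toKIdx B cfg (U₁ := U) specialUnitaryUnits_le_unitaryUnits hUG
  rw [dotProduct_comm u]
  show ∑ q, _ * u q = ∑ p, _ * F p
  rw [hT F u]
  exact Finset.sum_congr rfl fun p _ => mul_comm _ _

/-- ★ **THE BLOCK-L² `Q`-LETTER OVER ANY CARRIER, LENGTH-RATIO FORM** (w5's `B9QLettersAtPinsL2.blockBd_Q_pins_len` with the carrier generalised): above the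
[4] (2.60) threshold `log L ≤ ε(2L² − 1)M`, `‖1_{Δ(y)}Q(U)F‖₂ ≤ L·e^{(δ+ε)(ℓ+4)}·(√(n_y⁻¹)·Lʲη·(L^{j′}η)⁻¹)·e^{−δd(y,y′)}·‖1_{Δ(y′)}F‖₂` — transposed
(`B9SectDL2Decay.blockBd_of_adjoint` + `dotProduct_QcoKH_eqB`) from the carrier-generic `Q*`-letter `blockBd_QscoKH_len`, the transporter contraction from `hpar_of_mem`.
[cite: Balaban1985BackgroundPropagators, (3.46) p.398 + p.398 (remark after (3.47)), (3.13) p.393, Thm 3.13 p.426; Balaban1984PropagatorsII, Lemma 2.1 (2.60) p.234] -/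
theorem blockBd_Q_pinsB_len (x : MemberY d ℓ hd hL b₀ b₁ Mstar) {bI : FBondY x.toKIdx → IBondY x.toKIdx}
    (hβ1 : ∀ f : FBondY x.toKIdx, (geomT x.D).dist (β x.hN x.D x.hk (bI f)) (blkV1 x.hN x.D f) ≤ 1)
    {B : B9.Backgrounds} {cfg : B.Cfg → CfgY (Matrix (Fin N) (Fin N) ℂ) x.toKIdx}
    {U : B.Cfg} (hUG : ∀ μ z, cfg U μ z ∈ specialUnitaryUnits (Fin N))
    {δ ε : ℝ} (hδ : 0 ≤ δ) (hε : 0 < ε)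
    (hM : Real.log (geo9Y x).L ≤ ε * (2 * ((ℓ : ℝ) + 1) ^ 2 - 1) * (geo9Y x).M) (R₀ : ℝ) (H₀ : Prop) :
    BlockBd (g := toB6 (geo9Y x) R₀ H₀) (blkBK x.toKIdx bI) (blkHK x.toKIdx)
      (QcoKH x.toKIdx (trBasis N) B cfg (parBY x.toKIdx) U)
      (fun y y' => (geo9Y x).L * Real.exp ((δ + ε) * ((ℓ : ℝ) + 4)) *
        (Real.sqrt (((((ℓ + 1 : ℕ) : ℝ) ^ (d + 1)) ^ lvl x.hN x.D x.hk y)⁻¹) * (geo9Y x).len y * ((geo9Y x).len y')⁻¹) *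
          Real.exp (-(δ * (geo9Y x).dist y y'))) := by
  letI : Fintype (geo9K x.toKIdx).Site := (inferInstance : Fintype (geo9Y x).Site)
  have hadj := B9SectDL2Decay.blockBd_of_adjoint (g := toB6 (geo9Y x) R₀ H₀) (blk₁ := blkBK x.toKIdx bI) (blk₂ := blkHK x.toKIdx)
    (fun u F => dotProduct_QcoKH_eqB x hUG u F)
    (blockBd_QscoKH_len x.toKIdx (trBasis N) B cfg (parBY x.toKIdx) hβ1 (hpar_of_mem x hUG) hδ hε hM R₀ H₀) (fun y y' =>
      mul_nonneg (mul_nonneg (mul_nonneg (mul_nonneg (zero_le_one.trans (geo9K_one_le_L x.toKIdx)) (Real.exp_nonneg _))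
        (inv_nonneg.mpr (geo9K_len_pos x.toKIdx _).le)) (mul_nonneg (Real.sqrt_nonneg _) (geo9K_len_pos x.toKIdx _).le))
        (Real.exp_nonneg _))
  refine hadj.mono fun y y' => le_of_eq ?_
  change (geo9K x.toKIdx).Site at y y'
  simp only [geo9Y]
  rw [geo9K_dist_comm]
  ring

/-! ## §1 `G₀Q*` in block-L² -/

/-- ★★ **`G₀Q*` IN BLOCK-L² AT THE PINS** — the field `Letters313L2PZ.gQs` = `Letters313L2Pc.gQs`
(`‖1_{Δ(y)}G₀Q*μ‖₂ ≤ B₄·Lʲη(y)·(v_Z·Lʲη)(y′)·e^{−ρd(y,y′)}‖1_{Δ(y′)}μ‖₂`), every member above the transfer threshold `log L ≤ ε(2L²−1)M`, every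
SU(N)-valued `U` of any carrier: from the (3.46)₀ line of `G₀` (`hl0`, the G₀ layer's `Thm33G0L2P.l0` — HYPOTHESIS), dag-n06-w5's carrier-generic block-L² `Q*`-letter
`blockBd_QscoKH_len` at rate `δ_Q` and dag-n06-l's `gQs_l2_of_l0`; any `B₄ ≥ B₂·(L·e^{(δ_Q+ε)(ℓ+4)})·c`, rates `0 ≤ ρ ≤ δ₁`, `ρ + σ ≤ δ_Q`.
[cite: Balaban1985BackgroundPropagators, (3.153) p.426 + (3.46) p.398 + (3.110) p.417 + p.398 (remark after (3.47)); Balaban1984PropagatorsII, (2.26) p.228 + Lemma 2.1 (2.61) p.234; Balaban1984PropagatorsI, (1.18) p.20] -/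
theorem gQs_l2_pinsB (x : MemberY d ℓ hd hL b₀ b₁ Mstar) {bI : FBondY x.toKIdx → IBondY x.toKIdx}
    (hβ1 : ∀ f : FBondY x.toKIdx, (geomT x.D).dist (β x.hN x.D x.hk (bI f)) (blkV1 x.hN x.D f) ≤ 1)
    {Y W : Type} [Fintype Y] [Fintype W]
    {B : B9.Backgrounds} {cfg : B.Cfg → CfgY (Matrix (Fin N) (Fin N) ℂ) x.toKIdx}
    {𝔬 : Ops (geo9Y x) B (XBK (TrIdx N) x.toKIdx) Y (XHK (TrIdx N) x.toKIdx) W}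
    {H : Prop} {B₂ δ₁ σ c ρ δQ ε B₄ : ℝ}
    {U : B.Cfg} (hUG : ∀ μ z, cfg U μ z ∈ specialUnitaryUnits (Fin N))
    (hrow : RowSum (toB6 (geo9Y x) 1 H) σ c) (hB₂ : 0 ≤ B₂) (hδQ : 0 ≤ δQ) (hε : 0 < ε)
    (hM : Real.log (geo9Y x).L ≤ ε * (2 * ((ℓ : ℝ) + 1) ^ 2 - 1) * (geo9Y x).M)
    (hρ : 0 ≤ ρ) (hρ₁ : ρ ≤ δ₁) (hρQ : ρ + σ ≤ δQ)
    (hB₄ : B₂ * ((geo9Y x).L * Real.exp ((δQ + ε) * ((ℓ : ℝ) + 4))) * c ≤ B₄)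
    (hblk : 𝔬.blk = blkBK x.toKIdx bI) (hblkZ : 𝔬.blkZ = blkHK x.toKIdx)
    (hQs : 𝔬.Qstar U = QscoKH x.toKIdx (trBasis N) B cfg (parBY x.toKIdx) U)
    (hl0 : BlockBd (g := toB6 (geo9Y x) 1 H) 𝔬.blk 𝔬.blk (𝔬.G0 U)
      (fun (y y' : (geo9Y x).Site) => B₂ * (geo9Y x).len y * (geo9Y x).len y' * Real.exp (-(δ₁ * (geo9Y x).dist y y')))) :
    BlockBd (g := toB6 (geo9Y x) 1 H) 𝔬.blkZ 𝔬.blk (𝔬.G0 U ∘ₗ 𝔬.Qstar U)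
      (fun (y y' : (geo9Y x).Site) => B₄ * (geo9Y x).len y *
        (Real.sqrt (((((ℓ + 1 : ℕ) : ℝ) ^ (d + 1)) ^ lvl x.hN x.D x.hk y')⁻¹) * (geo9Y x).len y') * Real.exp (-(ρ * (geo9Y x).dist y y'))) := by
  letI : Fintype (geo9K x.toKIdx).Site := (inferInstance : Fintype (geo9Y x).Site)
  have hG : GeoOK (geo9Y x) := ⟨geo9Y_dist_triangle x, geo9Y_dist_comm x, geo9K_dist_nonneg x.toKIdx, geo9Y_len_pos x⟩
  have hqsL2 := blockBd_QscoKH_len x.toKIdx (trBasis N) B cfg (parBY x.toKIdx) hβ1 (hpar_of_mem x hUG) hδQ hε hM (1 : ℝ) H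
  rw [← hblkZ, ← hblk, ← hQs] at hqsL2
  have hBQ : 0 ≤ (geo9Y x).L * Real.exp ((δQ + ε) * ((ℓ : ℝ) + 4)) :=
    mul_nonneg (zero_le_one.trans (geo9K_one_le_L x.toKIdx)) (Real.exp_nonneg _)
  exact gQs_l2_of_l0 hG hrow (fun y => Real.sqrt_nonneg _) hB₂ hBQ hρ hρ₁ hρQ hB₄ hl0 hqsL2

/-! ## §2 `∇_UG₀Q*` and `∇_{U,ν}G₀Q*` in block-L² -/

/-- ★★ **`∇_UG₀Q*` IN BLOCK-L² AT THE PINS** — the field `Letters313L2PZ.dGQs` = `Letters313L2Pc.dGQs`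
(`‖1_{Δ(y)}∇_UG₀Q*μ‖₂ ≤ B₄·(v_Z·Lʲη)(y′)·e^{−ρd}‖1_{Δ(y′)}μ‖₂`), every member above the transfer threshold, every SU(N)-valued `U` of any carrier: from the (3.46)₁ line
of `∇_UG₀` (`hl1`, the G₀ layer's `Thm33G0L2P.l1` — HYPOTHESIS), `blockBd_QscoKH_len` and dag-n06-l's `dGQs_l2_of_l1`; any
`B₄ ≥ B₂·(L·e^{(δ_Q+ε)(ℓ+4)})·c`, rates `0 ≤ ρ ≤ δ₁`, `ρ + σ ≤ δ_Q`.
[cite: Balaban1985BackgroundPropagators, (3.153) p.426 + (3.46) p.398 + (3.110) p.417; Balaban1984PropagatorsII, (2.26) p.228 + Lemma 2.1 (2.61) p.234; Balaban1984PropagatorsI, (1.18) p.20] -/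
theorem dGQs_l2_pinsB (x : MemberY d ℓ hd hL b₀ b₁ Mstar) {bI : FBondY x.toKIdx → IBondY x.toKIdx}
    (hβ1 : ∀ f : FBondY x.toKIdx, (geomT x.D).dist (β x.hN x.D x.hk (bI f)) (blkV1 x.hN x.D f) ≤ 1)
    {Y W : Type} [Fintype Y] [Fintype W]
    {B : B9.Backgrounds} {cfg : B.Cfg → CfgY (Matrix (Fin N) (Fin N) ℂ) x.toKIdx}
    {𝔬 : Ops (geo9Y x) B (XBK (TrIdx N) x.toKIdx) Y (XHK (TrIdx N) x.toKIdx) W}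
    {H : Prop} {B₂ δ₁ σ c ρ δQ ε B₄ : ℝ}
    {U : B.Cfg} (hUG : ∀ μ z, cfg U μ z ∈ specialUnitaryUnits (Fin N))
    (hrow : RowSum (toB6 (geo9Y x) 1 H) σ c) (hB₂ : 0 ≤ B₂) (hδQ : 0 ≤ δQ) (hε : 0 < ε)
    (hM : Real.log (geo9Y x).L ≤ ε * (2 * ((ℓ : ℝ) + 1) ^ 2 - 1) * (geo9Y x).M)
    (hρ : 0 ≤ ρ) (hρ₁ : ρ ≤ δ₁) (hρQ : ρ + σ ≤ δQ)
    (hB₄ : B₂ * ((geo9Y x).L * Real.exp ((δQ + ε) * ((ℓ : ℝ) + 4))) * c ≤ B₄)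
    (hblk : 𝔬.blk = blkBK x.toKIdx bI) (hblkZ : 𝔬.blkZ = blkHK x.toKIdx)
    (hQs : 𝔬.Qstar U = QscoKH x.toKIdx (trBasis N) B cfg (parBY x.toKIdx) U)
    (hl1 : BlockBd (g := toB6 (geo9Y x) 1 H) 𝔬.blk 𝔬.blkY (𝔬.D U ∘ₗ 𝔬.G0 U)
      (fun (y y' : (geo9Y x).Site) => B₂ * (geo9Y x).len y' * Real.exp (-(δ₁ * (geo9Y x).dist y y')))) :
    BlockBd (g := toB6 (geo9Y x) 1 H) 𝔬.blkZ 𝔬.blkY (𝔬.D U ∘ₗ 𝔬.G0 U ∘ₗ 𝔬.Qstar U)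
      (fun (y y' : (geo9Y x).Site) => B₄ *
        (Real.sqrt (((((ℓ + 1 : ℕ) : ℝ) ^ (d + 1)) ^ lvl x.hN x.D x.hk y')⁻¹) * (geo9Y x).len y') * Real.exp (-(ρ * (geo9Y x).dist y y'))) := by
  letI : Fintype (geo9K x.toKIdx).Site := (inferInstance : Fintype (geo9Y x).Site)
  have hG : GeoOK (geo9Y x) := ⟨geo9Y_dist_triangle x, geo9Y_dist_comm x, geo9K_dist_nonneg x.toKIdx, geo9Y_len_pos x⟩
  have hqsL2 := blockBd_QscoKH_len x.toKIdx (trBasis N) B cfg (parBY x.toKIdx) hβ1 (hpar_of_mem x hUG) hδQ hε hM (1 : ℝ) H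
  rw [← hblkZ, ← hblk, ← hQs] at hqsL2
  have hBQ : 0 ≤ (geo9Y x).L * Real.exp ((δQ + ε) * ((ℓ : ℝ) + 4)) :=
    mul_nonneg (zero_le_one.trans (geo9K_one_le_L x.toKIdx)) (Real.exp_nonneg _)
  exact dGQs_l2_of_l1 hG hrow (fun y => Real.sqrt_nonneg _) hB₂ hBQ hρ hρ₁ hρQ hB₄ hl1 hqsL2

/-- ★★ **`∇_{U,ν}G₀Q*` IN BLOCK-L² AT THE PINS, EVERY DIRECTION `ν`** — the field `Letters313L2MZ.dGQsd ν`
(`‖1_{Δ(y)}∇_{U,ν}G₀Q*μ‖₂ ≤ B₄·(v_Z·Lʲη)(y′)·e^{−ρd}‖1_{Δ(y′)}μ‖₂`), every member above the transfer threshold, every SU(N)-valued `U` of any carrier: from the direction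
lines of `∇_{U,ν}G₀` (`hl1d`, the G₀ layer's `Thm33G0L2M.l1d` — HYPOTHESIS), `blockBd_QscoKH_len` and dag-n06-l's `dGQs_l2_of_l1` at `E := ∇_{U,ν}`;
any `B₄ ≥ B₂·(L·e^{(δ_Q+ε)(ℓ+4)})·c`, rates `0 ≤ ρ ≤ δ₁`, `ρ + σ ≤ δ_Q`.
[cite: Balaban1985BackgroundPropagators, (3.153) p.426 + (3.46) p.398 + (3.110) p.417 + Thm 3.13 p.426; Balaban1984PropagatorsII, (2.26) p.228 + Lemma 2.1 (2.61) p.234; Balaban1984PropagatorsI, (1.18) p.20] -/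
theorem dGQsd_l2_pinsB (x : MemberY d ℓ hd hL b₀ b₁ Mstar) {bI : FBondY x.toKIdx → IBondY x.toKIdx}
    (hβ1 : ∀ f : FBondY x.toKIdx, (geomT x.D).dist (β x.hN x.D x.hk (bI f)) (blkV1 x.hN x.D f) ≤ 1)
    {Y W P : Type} [Fintype Y] [Fintype W]
    {B : B9.Backgrounds} {cfg : B.Cfg → CfgY (Matrix (Fin N) (Fin N) ℂ) x.toKIdx}
    {𝔬 : Ops (geo9Y x) B (XBK (TrIdx N) x.toKIdx) Y (XHK (TrIdx N) x.toKIdx) W}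
    {Dd : B.Cfg → P → Module.End ℝ (XBK (TrIdx N) x.toKIdx → ℝ)}
    {H : Prop} {B₂ δ₁ σ c ρ δQ ε B₄ : ℝ}
    {U : B.Cfg} (hUG : ∀ μ z, cfg U μ z ∈ specialUnitaryUnits (Fin N))
    (hrow : RowSum (toB6 (geo9Y x) 1 H) σ c) (hB₂ : 0 ≤ B₂) (hδQ : 0 ≤ δQ) (hε : 0 < ε)
    (hM : Real.log (geo9Y x).L ≤ ε * (2 * ((ℓ : ℝ) + 1) ^ 2 - 1) * (geo9Y x).M)
    (hρ : 0 ≤ ρ) (hρ₁ : ρ ≤ δ₁) (hρQ : ρ + σ ≤ δQ)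
    (hB₄ : B₂ * ((geo9Y x).L * Real.exp ((δQ + ε) * ((ℓ : ℝ) + 4))) * c ≤ B₄)
    (hblk : 𝔬.blk = blkBK x.toKIdx bI) (hblkZ : 𝔬.blkZ = blkHK x.toKIdx)
    (hQs : 𝔬.Qstar U = QscoKH x.toKIdx (trBasis N) B cfg (parBY x.toKIdx) U)
    (hl1d : ∀ ν : P, BlockBd (g := toB6 (geo9Y x) 1 H) 𝔬.blk 𝔬.blk (Dd U ν ∘ₗ 𝔬.G0 U)
      (fun (y y' : (geo9Y x).Site) => B₂ * (geo9Y x).len y' * Real.exp (-(δ₁ * (geo9Y x).dist y y')))) :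
    ∀ ν : P, BlockBd (g := toB6 (geo9Y x) 1 H) 𝔬.blkZ 𝔬.blk (Dd U ν ∘ₗ 𝔬.G0 U ∘ₗ 𝔬.Qstar U)
      (fun (y y' : (geo9Y x).Site) => B₄ *
        (Real.sqrt (((((ℓ + 1 : ℕ) : ℝ) ^ (d + 1)) ^ lvl x.hN x.D x.hk y')⁻¹) * (geo9Y x).len y') * Real.exp (-(ρ * (geo9Y x).dist y y'))) := by
  letI : Fintype (geo9K x.toKIdx).Site := (inferInstance : Fintype (geo9Y x).Site)
  have hG : GeoOK (geo9Y x) := ⟨geo9Y_dist_triangle x, geo9Y_dist_comm x, geo9K_dist_nonneg x.toKIdx, geo9Y_len_pos x⟩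
  have hqsL2 := blockBd_QscoKH_len x.toKIdx (trBasis N) B cfg (parBY x.toKIdx) hβ1 (hpar_of_mem x hUG) hδQ hε hM (1 : ℝ) H
  rw [← hblkZ, ← hblk, ← hQs] at hqsL2
  have hBQ : 0 ≤ (geo9Y x).L * Real.exp ((δQ + ε) * ((ℓ : ℝ) + 4)) :=
    mul_nonneg (zero_le_one.trans (geo9K_one_le_L x.toKIdx)) (Real.exp_nonneg _)
  intro ν
  exact dGQs_l2_of_l1 hG hrow (fun y => Real.sqrt_nonneg _) hB₂ hBQ hρ hρ₁ hρQ hB₄ (hl1d ν) hqsL2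

/-! ## §3 `∇_ν∇_μG₀Q*` in block-L² -/

/-- ★★ **`∇_ν∇_μG₀Q*` IN BLOCK-L² AT THE PINS, EVERY PAIR `q = (ν, μ)`** — the field `Letters313L2PZ.ddGQs q` = `Letters313L2Pc.ddGQs q`
(`‖1_{Δ(y)}∇_ν∇_μG₀Q*μ'‖₂ ≤ B₄·(Lʲη(y))⁻¹·(v_Z·Lʲη)(y′)·e^{−ρd}‖1_{Δ(y′)}μ'‖₂`), every member above the transfer threshold, every SU(N)-valued `U` of any carrier: from the
(3.46)₃ lines of `∇_ν∇_μG₀` (`hl3`, the G₀ layer's `Thm33G0L2P.l3` — HYPOTHESIS), `blockBd_QscoKH_len` and dag-n06-l's `ddGQs_l2_of_l3`; any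
`B₄ ≥ B₂·(L·e^{(δ_Q+ε)(ℓ+4)})·c`, rates `0 ≤ ρ ≤ δ₁`, `ρ + σ ≤ δ_Q`.
[cite: Balaban1985BackgroundPropagators, (3.153) p.426 + (3.46) p.398 + (3.110) p.417 + Thm 3.13 p.426; Balaban1984PropagatorsII, (2.26) p.228 + Lemma 2.1 (2.61) p.234; Balaban1984PropagatorsI, (1.18) p.20] -/
theorem ddGQs_l2_pinsB (x : MemberY d ℓ hd hL b₀ b₁ Mstar) {bI : FBondY x.toKIdx → IBondY x.toKIdx}
    (hβ1 : ∀ f : FBondY x.toKIdx, (geomT x.D).dist (β x.hN x.D x.hk (bI f)) (blkV1 x.hN x.D f) ≤ 1)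
    {Y W P : Type} [Fintype Y] [Fintype W]
    {B : B9.Backgrounds} {cfg : B.Cfg → CfgY (Matrix (Fin N) (Fin N) ℂ) x.toKIdx}
    {𝔬 : Ops (geo9Y x) B (XBK (TrIdx N) x.toKIdx) Y (XHK (TrIdx N) x.toKIdx) W}
    {Dd : B.Cfg → P → Module.End ℝ (XBK (TrIdx N) x.toKIdx → ℝ)}
    {H : Prop} {B₂ δ₁ σ c ρ δQ ε B₄ : ℝ}
    {U : B.Cfg} (hUG : ∀ μ z, cfg U μ z ∈ specialUnitaryUnits (Fin N))
    (hrow : RowSum (toB6 (geo9Y x) 1 H) σ c) (hB₂ : 0 ≤ B₂) (hδQ : 0 ≤ δQ) (hε : 0 < ε)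
    (hM : Real.log (geo9Y x).L ≤ ε * (2 * ((ℓ : ℝ) + 1) ^ 2 - 1) * (geo9Y x).M)
    (hρ : 0 ≤ ρ) (hρ₁ : ρ ≤ δ₁) (hρQ : ρ + σ ≤ δQ)
    (hB₄ : B₂ * ((geo9Y x).L * Real.exp ((δQ + ε) * ((ℓ : ℝ) + 4))) * c ≤ B₄)
    (hblk : 𝔬.blk = blkBK x.toKIdx bI) (hblkZ : 𝔬.blkZ = blkHK x.toKIdx)
    (hQs : 𝔬.Qstar U = QscoKH x.toKIdx (trBasis N) B cfg (parBY x.toKIdx) U)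
    (hl3 : ∀ q : P × P, BlockBd (g := toB6 (geo9Y x) 1 H) 𝔬.blk 𝔬.blk ((Dd U q.1 ∘ₗ Dd U q.2) ∘ₗ 𝔬.G0 U)
      (fun (y y' : (geo9Y x).Site) => B₂ * (((geo9Y x).len y)⁻¹ * (geo9Y x).len y') * Real.exp (-(δ₁ * (geo9Y x).dist y y')))) :
    ∀ q : P × P, BlockBd (g := toB6 (geo9Y x) 1 H) 𝔬.blkZ 𝔬.blk ((Dd U q.1 ∘ₗ Dd U q.2) ∘ₗ 𝔬.G0 U ∘ₗ 𝔬.Qstar U)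
      (fun (y y' : (geo9Y x).Site) => B₄ * (((geo9Y x).len y)⁻¹ *
        (Real.sqrt (((((ℓ + 1 : ℕ) : ℝ) ^ (d + 1)) ^ lvl x.hN x.D x.hk y')⁻¹) * (geo9Y x).len y')) * Real.exp (-(ρ * (geo9Y x).dist y y'))) := by
  letI : Fintype (geo9K x.toKIdx).Site := (inferInstance : Fintype (geo9Y x).Site)
  have hG : GeoOK (geo9Y x) := ⟨geo9Y_dist_triangle x, geo9Y_dist_comm x, geo9K_dist_nonneg x.toKIdx, geo9Y_len_pos x⟩
  have hqsL2 := blockBd_QscoKH_len x.toKIdx (trBasis N) B cfg (parBY x.toKIdx) hβ1 (hpar_of_mem x hUG) hδQ hε hM (1 : ℝ) H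
  rw [← hblkZ, ← hblk, ← hQs] at hqsL2
  have hBQ : 0 ≤ (geo9Y x).L * Real.exp ((δQ + ε) * ((ℓ : ℝ) + 4)) :=
    mul_nonneg (zero_le_one.trans (geo9K_one_le_L x.toKIdx)) (Real.exp_nonneg _)
  intro q
  exact ddGQs_l2_of_l3 hG hrow (fun y => Real.sqrt_nonneg _) hB₂ hBQ hρ hρ₁ hρQ hB₄ (hl3 q) hqsL2

/-! ## §4 The averaging operator `Q` in block-L² -/

/-- ★ **`Q(U)` IN BLOCK-L² AT THE PINS, RE-LETTERED TO THE SCHEMA KERNEL** — the field `Letters313L2PZ.q` = `Letters313L2Pc.q`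
(`‖1_{Δ(y)}Q(U)F‖₂ ≤ B₄·(v_Z·Lʲη)(y)·(Lʲη(y′))⁻¹·e^{−ρd}‖1_{Δ(y′)}F‖₂`), every member above the transfer threshold, every SU(N)-valued `U` of any carrier: the carrier-generic
`blockBd_Q_pinsB_len` (§0) (kernel `L·e^{(δ_Q+ε)(ℓ+4)}·(…)·e^{−δ_Qd}`) read through the pins `hblk`, `hblkZ`, `hQ : 𝔬.Q U = QcoKH … U` and
weakened to any `B₄ ≥ L·e^{(δ_Q+ε)(ℓ+4)}` and any rate `ρ ≤ δ_Q`.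
[cite: Balaban1985BackgroundPropagators, (3.110) p.417 + (3.46) p.398 + (3.153) p.426 + (3.13) p.393; Balaban1984PropagatorsI, (1.18) p.20] -/
theorem q_l2_pinsB (x : MemberY d ℓ hd hL b₀ b₁ Mstar) {bI : FBondY x.toKIdx → IBondY x.toKIdx}
    (hβ1 : ∀ f : FBondY x.toKIdx, (geomT x.D).dist (β x.hN x.D x.hk (bI f)) (blkV1 x.hN x.D f) ≤ 1)
    {Y W : Type} [Fintype Y] [Fintype W]
    {B : B9.Backgrounds} {cfg : B.Cfg → CfgY (Matrix (Fin N) (Fin N) ℂ) x.toKIdx}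
    {𝔬 : Ops (geo9Y x) B (XBK (TrIdx N) x.toKIdx) Y (XHK (TrIdx N) x.toKIdx) W}
    {H : Prop} {ρ δQ ε B₄ : ℝ}
    {U : B.Cfg} (hUG : ∀ μ z, cfg U μ z ∈ specialUnitaryUnits (Fin N))
    (hδQ : 0 ≤ δQ) (hε : 0 < ε) (hM : Real.log (geo9Y x).L ≤ ε * (2 * ((ℓ : ℝ) + 1) ^ 2 - 1) * (geo9Y x).M)
    (hρQ : ρ ≤ δQ) (hB₄ : (geo9Y x).L * Real.exp ((δQ + ε) * ((ℓ : ℝ) + 4)) ≤ B₄)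
    (hblk : 𝔬.blk = blkBK x.toKIdx bI) (hblkZ : 𝔬.blkZ = blkHK x.toKIdx)
    (hQ : 𝔬.Q U = QcoKH x.toKIdx (trBasis N) B cfg (parBY x.toKIdx) U) :
    BlockBd (g := toB6 (geo9Y x) 1 H) 𝔬.blk 𝔬.blkZ (𝔬.Q U)
      (fun (y y' : (geo9Y x).Site) => B₄ * (Real.sqrt (((((ℓ + 1 : ℕ) : ℝ) ^ (d + 1)) ^ lvl x.hN x.D x.hk y)⁻¹) * (geo9Y x).len y *
        ((geo9Y x).len y')⁻¹) * Real.exp (-(ρ * (geo9Y x).dist y y'))) := by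
  letI : Fintype (geo9K x.toKIdx).Site := (inferInstance : Fintype (geo9Y x).Site)
  have hq := blockBd_Q_pinsB_len x hβ1 hUG hδQ hε hM (1 : ℝ) H
  rw [← hblkZ, ← hblk, ← hQ] at hq
  refine hq.mono fun y y' => ?_
  have hd0 : 0 ≤ (geo9Y x).dist y y' := geo9K_dist_nonneg x.toKIdx y y'
  have h1 : Real.exp (-(δQ * (geo9Y x).dist y y')) ≤ Real.exp (-(ρ * (geo9Y x).dist y y')) :=
    Real.exp_le_exp.mpr (neg_le_neg (mul_le_mul_of_nonneg_right hρQ hd0))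
  have hw : 0 ≤ Real.sqrt (((((ℓ + 1 : ℕ) : ℝ) ^ (d + 1)) ^ lvl x.hN x.D x.hk y)⁻¹) * (geo9Y x).len y * ((geo9Y x).len y')⁻¹ :=
    mul_nonneg (mul_nonneg (Real.sqrt_nonneg _) (geo9Y_len_pos x y).le) (inv_nonneg.mpr (geo9Y_len_pos x y').le)
  have h0 : 0 ≤ (geo9Y x).L * Real.exp ((δQ + ε) * ((ℓ : ℝ) + 4)) :=
    mul_nonneg (zero_le_one.trans (geo9K_one_le_L x.toKIdx)) (Real.exp_nonneg _)
  calc (geo9Y x).L * Real.exp ((δQ + ε) * ((ℓ : ℝ) + 4)) *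
        (Real.sqrt (((((ℓ + 1 : ℕ) : ℝ) ^ (d + 1)) ^ lvl x.hN x.D x.hk y)⁻¹) * (geo9Y x).len y * ((geo9Y x).len y')⁻¹) *
          Real.exp (-(δQ * (geo9Y x).dist y y'))
      ≤ (geo9Y x).L * Real.exp ((δQ + ε) * ((ℓ : ℝ) + 4)) *
        (Real.sqrt (((((ℓ + 1 : ℕ) : ℝ) ^ (d + 1)) ^ lvl x.hN x.D x.hk y)⁻¹) * (geo9Y x).len y * ((geo9Y x).len y')⁻¹) *
          Real.exp (-(ρ * (geo9Y x).dist y y')) := mul_le_mul_of_nonneg_left h1 (mul_nonneg h0 hw)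
    _ ≤ B₄ * (Real.sqrt (((((ℓ + 1 : ℕ) : ℝ) ^ (d + 1)) ^ lvl x.hN x.D x.hk y)⁻¹) * (geo9Y x).len y * ((geo9Y x).len y')⁻¹) *
          Real.exp (-(ρ * (geo9Y x).dist y y')) :=
        mul_le_mul_of_nonneg_right (mul_le_mul_of_nonneg_right hB₄ hw) (Real.exp_nonneg _)

end Literature.MathematicalPhysics.QuantumFieldTheory.Balaban1983to89.B9LettersZQstarFieldsAtPinsL2R

end
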